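import Literature.MathematicalPhysics.QuantumFieldTheory.Balaban1983to89.B9Eq3132TentOperator
import Literature.MathematicalPhysics.QuantumFieldTheory.Balaban1983to89.B6QGQCoerciveKLevelV1

/-!
# `Balaban1983to89.B9Eq3132ApproxRightInverse` — T. Bałaban, *Propagators and renormalization transformations for lattice gauge theories. II*, Commun. Math. Phys.
# **96** (1984) 223–250 [Balaban1984PropagatorsII], (2.147) p. 248 with [Balaban1985BackgroundPropagators] (3.13) p. 393, (3.35) p. 396, (3.132) p. 422: THE TREE'S TENT
# BUMPS, TRANSPORTED BY def-Y's TRANSPORTERS, ARE AN APPROXIMATE RIGHT INVERSE OF `Q(U)` AGAINST THE WEIGHTS `Λ⁻¹` AT EVERY `SU(N)`-VALUED BACKGROUND —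
# (P′2) `⅛‖Ψ‖² ≤ Re tr⟨Q(U)(T_θΨ), Λ⁻¹Ψ⟩` with `θ_y = φ_y∕m_y` (the U = 1 dominance bookkeeping of `B6QGQCoerciveKLevelV1` transferred verbatim)

statement-level skeleton of published theorems with citation tags; proofs where landed; nothing here is a claim about the Yang–Mills mass gap

THE PRINT.  [4] p. 248 *«The operator C is an inverse to the operator of the quadratic form (2.120), hence it is bounded from below by an inverse of an upper bound of this
form … we get ⟨B,(QGQ*)B⟩ ≥ γ₀‖B‖² (2.147) with a positive constant γ₀ depending on d and L only»*.  The tree realises this at `U = 1` with explicit tent bumps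
`φ_i` on the base blocks (`B6QGQTestBumpsKLevelV1.bump`: longitudinal `τ(u) = (r − |u − c|)⁺`, `r = ⌊Lʲ∕5⌋`, transverse `min(c+1, Lʲ − c)`) and the dominance estimate
`B6QGQCoerciveKLevelV1.dominance` (`⟨QΦv, v⟩ ≥ ⅛ΣΛ_i²v_i²`, AM–GM pair by pair: `term_lower`, `sum_E1_le … sum_E4_le`).  [B9] (3.13) p. 393: `Q(U)` carries the transporters
`R(τ_U(y,f))` (def-Y: `QY parB U = trLiftY q (qT parB U)`); (3.35) p. 396: the backgrounds are `G`-valued.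

WHY THIS FILE (dag-n06-i gen 13, N06 bundle F4, row 26).  `B9Eq3132CoerciveVariational.hcoA_of_testFamily` reduces the row-26 coercivity binder to row 17's `hΔA` and a test
family `T x U` with (P′2) `(1−ϑ) trIP 1 Ψ Ψ ≤ trIP 1 (QY … U (T x U Ψ)) (Λ⁻¹•Ψ)` and an energy bound (P′1).  THIS FILE discharges (P′2) for the EXPLICIT family
`T := tentOp (bumpProfile)` of `B9Eq3132TentOperator` with the tree's bumps as profiles, `θ_y := φ_y∕m_y`, uniformly in the member and in `U` (`ϑ = 7∕8`): by
`trIP_QY_tentOp_ge` the pairing is `≥ ‖Ψ‖² − Σ_{y₂≠y} Λ_{y₂}⁻¹Λ_y e(y₂,y)‖Ψ y‖_F‖Ψ y₂‖_F` with the FLAT matrix `e(y₂,y) = (Qφ_y)_{y₂}∕m_y` (the transporters are Frobenius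
isometries and cancel on the diagonal), and `Λ_{y₂}⁻¹Λ_y e(y₂,y) a_y a_{y₂}` is exactly the `(i,i′) = (y,y₂)` cross term of the tree's `⟨QΦv, v⟩` at `v_z = a_z∕Λ_z`; the tree's
pointwise AM–GM bound `term_lower`, applied at the sign-flipped vector `v_y = a_y∕Λ_y`, `v_{y₂} = −a_{y₂}∕Λ_{y₂}` (its error densities `E₁…E₄` depend on `v²` only), bounds it
by `(E₁+E₂+E₃+E₄)(y,y₂)`, and `sum_E1_le … sum_E4_le` sum these to `(⅛+¼+¼+¼)Σ_y a_y² = ⅞‖Ψ‖²`.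

WHAT IS PROVED (sorry-free).
* §1 `bumpProfile i y f := bump y f ∕ mass y`, `bumpProfile_ok : ProfileOK i 1 (bumpProfile i)` (non-negative, supported on the `μ_y`-bonds of the base block, `Σ_f q_y θ_y = 1`),
  `eWt_bumpProfile` (`e(y₂,y) = (Qφ_y)_{y₂}∕m_y`), `wt_eq_lamY_sq` (`Λ_y²` of the tree = `lamY²`).
* §2 ★ `cross_pair_le` — `Λ_{y₂}⁻¹Λ_y e(y₂,y)·a_y a_{y₂} ≤ (E₁+E₂+E₃+E₄)(v)(y,y₂)` for `y₂ ≠ y`, `v_z = a_z∕Λ_z`; ★★ `cross_sum_le` — `Σ_{y₂}Σ_{y≠y₂} … ≤ ⅞·Σ_y a_y²`.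
* §3 ★★★ `p2_bump` — `(1 − ⅞)·trIP 1 Ψ Ψ ≤ trIP 1 (QY i (parBY i) U (tentOp i (bumpProfile i) U Ψ)) (fun y => lamInvY i y • Ψ y)` for every `SU(N)`-valued `U`;
  `p2_bump_member` — the same at a member of def-Y's record for every (3.35)-regular background: the (P′2) conjunct of `hcoA_of_testFamily`'s `hT` for this family, `ϑ = ⅞`.

HONEST SCOPE.  Finite-dimensional algebra over landed objects (def-Y's letters, r03's weights, the tree's U = 1 bumps and their bookkeeping); standing side conditions are the
index's (`1 ≤ k`, `4 ≤ ℓ`, `2 ≤ R·M̂`, `c_f ≠ 0`; torus periods `≥ 2` automatic).  The ENERGY half (P′1) of the test family under (3.35) and row 17's `hΔA` remain the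
displayed hypotheses behind row 26's coercivity; nothing of [B9] is asserted; count-neutral; N06 NOT discharged.  Cell `pub-ymgap` (HUMAN RULING D-0062), Track A node
N06 [B9], seat `pub-ymgap-dag-n06-i` (gen 13), 2026-08-27; a NEW file.
-/

noncomputable section

namespace Literature.MathematicalPhysics.QuantumFieldTheory.Balaban1983to89.B9Eq3132ApproxRightInverse

open Node00
open B6KLevelCensusIndexV1 (KIdx)
open B6Ineq2142KLevelV1 (qwt qwt_nonneg lvl base)
open B6GlobalChartV1 (PV domT)
open B6SectAOperatorsV1 (QE BondIdxSpace)
open B5Eq118OneStroke (iterBlockOf mem_iterBlock)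
open B9Thm311ReadingCoords (trIP)
open B9Eq3132NuReading (lamY lamY_pos lamInvY lamInvY_pos)
open B9Eq3132Ineq2142Covariant (two_le_RMh)
open B9GeoLemma21KLevelV1 (one_le_k)
open B6AvgWeightsKLevelV1 (muOff muOff_lt PV_L)
open B6IndexBondLayersKLevelV1 (ProfileOK InLayer)
open B9Eq3132TentOperator (fro fro_nonneg tentOp eWt trIP_QY_tentOp_ge trIP_one_eq_sum_fro_sq)
open B6QGQTestBumpsKLevelV1 (bump bumpFn bumpFn_nonneg bump_ne_zero_imp mass_pos QE_apply_eq_sum_qwt)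
open B6QGQCoerciveKLevelV1 (mass nu E1 E2 E3 E4 term_lower sum_E1_le sum_E2_le sum_E3_le sum_E4_le)
open B6Prop27KLevelV1 (wt)
open B7Prop2SpecialUnitary (specialUnitaryUnits)
open B9PinMembersKLevelV1 (MemberY bg9Y)
open scoped Matrix Matrix.Norms.L2Operator

variable {N : ℕ} {d ℓ : ℕ} {hd : 1 ≤ d + 1} {hL : Odd (ℓ + 1) ∧ 1 < ℓ + 1} {b₀ b₁ : ℝ} (i : KIdx d ℓ hd hL b₀ b₁)

/-! ## §1 The bump profiles `θ_y = φ_y ∕ m_y` -/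

/-- the torus periods are `≥ 2` at every level (automatic on `PV`). [cite: Balaban1984PropagatorsII, (2.3) p.224, bookkeeping] -/
theorem two_le_sitesPerDir (n : ℕ) : 2 ≤ (PV d ℓ i.m i.K hd hL).sitesPerDir n :=
  Nat.succ_le_of_lt ((PV d ℓ i.m i.K hd hL).one_lt_sitesPerDir n)

/-- `m_y > 0` at the index. [cite: Balaban1984PropagatorsII, (2.147) p.248, bookkeeping] -/
theorem mass_pos' (y : IBondY i) : 0 < mass i.hN i.D i.hk y :=
  mass_pos i.hN i.D i.hk (one_le_k i) i.hℓ y (two_le_sitesPerDir i _)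

/-- ★ **THE BUMP PROFILE** `θ_y(f) := φ_y(f)∕m_y` — the tree's U = 1 tent bump of the index bond `y`, normalised by its own `Q`-mass.
[cite: Balaban1984PropagatorsII, (2.147) p.248 (test functions), bookkeeping ours] -/
def bumpProfile (y : IBondY i) (f : FBondY i) : ℝ := bump i.hN i.D i.hk y f / mass i.hN i.D i.hk y

/-- `θ ≥ 0`. [cite: Balaban1984PropagatorsII, (2.147) p.248, bookkeeping] -/
theorem bumpProfile_nonneg (y : IBondY i) (f : FBondY i) : 0 ≤ bumpProfile i y f :=
  div_nonneg (bumpFn_nonneg i.hN i.D i.hk y f) (mass_pos' i y).le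

/-- **NORMALISATION `Σ_f q_y(f)θ_y(f) = 1`** (`(Qφ_y)_y = m_y`). [cite: Balaban1984PropagatorsII, (2.147) p.248; Balaban1984PropagatorsI, (1.18) p.20] -/
theorem bumpProfile_norm (y : IBondY i) : ∑ f, qwt i.hN i.D i.hk y f * bumpProfile i y f = 1 := by
  unfold bumpProfile
  simp_rw [mul_div_assoc']
  rw [← Finset.sum_div, ← QE_apply_eq_sum_qwt]
  exact div_self (mass_pos' i y).ne'

/-- **THE BUMP PROFILES ARE ADMISSIBLE** (`ProfileOK` with `ε = 1`: non-negative, supported on the `μ_y`-bonds issuing from `Bʲ(base y)`, normalised).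
[cite: Balaban1984PropagatorsII, (2.147) p.248, bookkeeping] -/
theorem bumpProfile_ok : ProfileOK i 1 (bumpProfile i) := by
  refine ⟨bumpProfile_nonneg i, fun y f hf => ?_, bumpProfile_norm i⟩
  have hb : bump i.hN i.D i.hk y f ≠ 0 := fun h => hf (by rw [bumpProfile, h, zero_div])
  obtain ⟨hdir, hsrc⟩ := bump_ne_zero_imp i.hN i.D i.hk y hb
  refine ⟨hdir, (mem_iterBlock _ _ _).1 hsrc, fun _ => ?_, fun _ => ?_⟩
  · rw [sub_self, zero_mul]; positivity
  · rw [one_mul]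
    have h := muOff_lt (P := PV d ℓ i.m i.K hd hL) (lvl i.hN i.D i.hk y) f.src y.1.2.dir
    rw [PV_L i] at h
    have h' : muOff (lvl i.hN i.D i.hk y) f.src y.1.2.dir + 1 ≤ (ℓ + 1) ^ (lvl i.hN i.D i.hk y) := h
    exact_mod_cast h'

/-- **THE FLAT MATRIX OF THE BUMP PROFILES**: `e(y₂, y) = (Qφ_y)_{y₂}∕m_y`. [cite: Balaban1984PropagatorsII, (2.147) p.248; Balaban1984PropagatorsI, (1.18) p.20] -/
theorem eWt_bumpProfile (y₂ y : IBondY i) : eWt i (bumpProfile i) y₂ y = QE (domT i.hN i.D i.hk) (bump i.hN i.D i.hk y) y₂ / mass i.hN i.D i.hk y := by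
  unfold eWt bumpProfile
  simp_rw [mul_div_assoc']
  rw [← Finset.sum_div, ← QE_apply_eq_sum_qwt]

/-- the tree's level weight `Λ_y²` (`B6Prop27KLevelV1.wt`) is `lamY²`. [cite: Balaban1984PropagatorsII, (2.81) p.237, (2.142) p.248, bookkeeping] -/
theorem wt_eq_lamY_sq (y : IBondY i) : wt i.hN i.D i.hk i.cf y = lamY i y ^ 2 := (B6Prop27KLevelV1.lam_sq i.hN i.D i.hk i.hcf y).symm

/-! ## §2 The cross terms, pair by pair, through the tree's AM–GM densities -/

/-- the vector `v_z = a_z∕Λ_z` of the tree's dominance bookkeeping. [cite: Balaban1984PropagatorsII, (2.147) p.248, bookkeeping] -/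
def vOf (a : IBondY i → ℝ) : BondIdxSpace (domT i.hN i.D i.hk) := WithLp.toLp 2 fun z => a z / lamY i z

/-- `v_z = a_z∕Λ_z`. [cite: Balaban1984PropagatorsII, (2.147) p.248, bookkeeping] -/
theorem vOf_apply (a : IBondY i → ℝ) (z : IBondY i) : vOf i a z = a z / lamY i z := rfl

/-- `Λ_z²·v_z² = a_z²`. [cite: Balaban1984PropagatorsII, (2.147) p.248, bookkeeping] -/
theorem wt_mul_vOf_sq (a : IBondY i → ℝ) (z : IBondY i) : wt i.hN i.D i.hk i.cf z * vOf i a z ^ 2 = a z ^ 2 := by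
  rw [wt_eq_lamY_sq, vOf_apply, div_pow, mul_div_cancel₀ _ (pow_ne_zero 2 (lamY_pos i z).ne')]

/-- ★ **ONE CROSS TERM**: for `y₂ ≠ y`, `Λ_{y₂}⁻¹Λ_y·e(y₂,y)·a_y a_{y₂} ≤ (E₁ + E₂ + E₃ + E₄)(v)(y, y₂)` with `v_z = a_z∕Λ_z` — the tree's `term_lower` at the vector
`(…, a_y∕Λ_y, …, −a_{y₂}∕Λ_{y₂}, …)`, whose right side is `−Λ_{y₂}⁻¹Λ_y e(y₂,y) a_y a_{y₂}` (`ν_y(Qφ_y)_{y₂} = Λ_y² e(y₂,y)`) and whose densities see only squares.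
[cite: Balaban1984PropagatorsII, (2.147) p.248] -/
theorem cross_pair_le (a : IBondY i → ℝ) {y y₂ : IBondY i} (hne : y₂ ≠ y) :
    lamInvY i y₂ * lamY i y * eWt i (bumpProfile i) y₂ y * (a y * a y₂) ≤
      E1 i.hN i.D i.hk i.cf (vOf i a) y y₂ + E2 i.hN i.D i.hk i.cf (vOf i a) y y₂ + E3 i.hN i.D i.hk i.cf (vOf i a) y y₂ + E4 i.hN i.D i.hk i.cf (vOf i a) y y₂ := by
  classical
  set v : BondIdxSpace (domT i.hN i.D i.hk) := WithLp.toLp 2 fun z => if z = y₂ then -(a z / lamY i z) else a z / lamY i z with hv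
  have hv1 : v y = a y / lamY i y := by rw [hv, PiLp.toLp_apply, if_neg hne.symm]
  have hv2 : v y₂ = -(a y₂ / lamY i y₂) := by rw [hv, PiLp.toLp_apply, if_pos rfl]
  have ha1 : vOf i a y = a y / lamY i y := rfl
  have ha2 : vOf i a y₂ = a y₂ / lamY i y₂ := rfl
  have e1 : E1 i.hN i.D i.hk i.cf v y y₂ = E1 i.hN i.D i.hk i.cf (vOf i a) y y₂ := by unfold E1; rw [hv1, ha1]
  have e2 : E2 i.hN i.D i.hk i.cf v y y₂ = E2 i.hN i.D i.hk i.cf (vOf i a) y y₂ := by unfold E2; rw [hv2, ha2, neg_sq]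
  have e3 : E3 i.hN i.D i.hk i.cf v y y₂ = E3 i.hN i.D i.hk i.cf (vOf i a) y y₂ := by unfold E3; rw [hv1, ha1]
  have e4 : E4 i.hN i.D i.hk i.cf v y y₂ = E4 i.hN i.D i.hk i.cf (vOf i a) y y₂ := by unfold E4; rw [hv2, ha2, neg_sq]
  have h := term_lower i.hN i.D i.hk (one_le_k i) i.hℓ (two_le_RMh i) (fun n _ => two_le_sitesPerDir i n) i.hcf v y y₂
  rw [if_neg hne, e1, e2, e3, e4, hv1, hv2] at h
  -- identify the right side: `(a_y∕Λ_y)·ν_y·(Qφ_y)_{y₂}·(−a_{y₂}∕Λ_{y₂}) = −Λ_{y₂}⁻¹Λ_y e(y₂,y) a_y a_{y₂}`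
  have hm := mass_pos' i y
  have hΛ := lamY_pos i y
  have hΛ₂ := lamY_pos i y₂
  have e : a y / lamY i y * nu i.hN i.D i.hk i.cf y * QE (domT i.hN i.D i.hk) (bump i.hN i.D i.hk y) y₂ * -(a y₂ / lamY i y₂) =
      -(lamInvY i y₂ * lamY i y * eWt i (bumpProfile i) y₂ y * (a y * a y₂)) := by
    rw [eWt_bumpProfile, nu, wt_eq_lamY_sq, lamInvY]
    field_simp
  rw [e] at h
  linarith

/-- the diagonal densities vanish: `E_k(v)(y, y) = 0`. [cite: Balaban1984PropagatorsII, (2.147) p.248, bookkeeping] -/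
theorem E_diag_eq_zero (v : BondIdxSpace (domT i.hN i.D i.hk)) (y : IBondY i) :
    E1 i.hN i.D i.hk i.cf v y y + E2 i.hN i.D i.hk i.cf v y y + E3 i.hN i.D i.hk i.cf v y y + E4 i.hN i.D i.hk i.cf v y y = 0 := by
  have h1 : ¬ (lvl i.hN i.D i.hk y = lvl i.hN i.D i.hk y ∧ y ≠ y) := fun h => h.2 rfl
  have h2 : ¬ (lvl i.hN i.D i.hk y = lvl i.hN i.D i.hk y + 1 ∧ QE (domT i.hN i.D i.hk) (bump i.hN i.D i.hk y) y ≠ 0) := fun h => by omega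
  unfold E1 E2 E3 E4
  rw [if_neg h1, if_neg h2]
  norm_num

/-- ★★ **THE CROSS TERMS TOGETHER**: `Σ_{y₂} Σ_{y ≠ y₂} Λ_{y₂}⁻¹Λ_y e(y₂,y) a_y a_{y₂} ≤ ⅞·Σ_y a_y²` (`sum_E1_le` ⅛, `sum_E2_le` ¼, `sum_E3_le` ¼, `sum_E4_le` ¼ at `v = a∕Λ`,
`Λ_y²v_y² = a_y²`). [cite: Balaban1984PropagatorsII, (2.147) p.248] -/
theorem cross_sum_le (a : IBondY i → ℝ) :
    ∑ y₂, ∑ y ∈ Finset.univ.erase y₂, lamInvY i y₂ * lamY i y * eWt i (bumpProfile i) y₂ y * (a y * a y₂) ≤ (7 / 8) * ∑ y, a y ^ 2 := by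
  classical
  set v := vOf i a with hv
  set E : IBondY i → IBondY i → ℝ := fun y y₂ =>
    E1 i.hN i.D i.hk i.cf v y y₂ + E2 i.hN i.D i.hk i.cf v y y₂ + E3 i.hN i.D i.hk i.cf v y y₂ + E4 i.hN i.D i.hk i.cf v y y₂ with hE
  have h1 : ∑ y₂, ∑ y ∈ Finset.univ.erase y₂, lamInvY i y₂ * lamY i y * eWt i (bumpProfile i) y₂ y * (a y * a y₂) ≤ ∑ y₂, ∑ y ∈ Finset.univ.erase y₂, E y y₂ :=
    Finset.sum_le_sum fun y₂ _ => Finset.sum_le_sum fun y hy => cross_pair_le i a (Finset.ne_of_mem_erase hy).symm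
  have h2 : ∑ y₂, ∑ y ∈ Finset.univ.erase y₂, E y y₂ = ∑ y, ∑ y₂, E y y₂ := by
    rw [Finset.sum_congr rfl fun y₂ _ => Finset.sum_erase (f := fun y => E y y₂) Finset.univ (E_diag_eq_zero i v y₂)]
    exact Finset.sum_comm
  have h3 : ∑ y, ∑ y₂, E y y₂ = (∑ y, ∑ y₂, E1 i.hN i.D i.hk i.cf v y y₂) + (∑ y, ∑ y₂, E2 i.hN i.D i.hk i.cf v y y₂) +
      (∑ y, ∑ y₂, E3 i.hN i.D i.hk i.cf v y y₂) + ∑ y, ∑ y₂, E4 i.hN i.D i.hk i.cf v y y₂ := by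
    simp only [hE, Finset.sum_add_distrib]
  have hper : ∀ n, n ≤ i.k + 1 → 2 ≤ (PV d ℓ i.m i.K hd hL).sitesPerDir n := fun n _ => two_le_sitesPerDir i n
  have b1 := sum_E1_le i.hN i.D i.hk (one_le_k i) i.hℓ hper i.hcf v
  have b2 := sum_E2_le i.hN i.D i.hk (one_le_k i) i.hℓ hper i.hcf v
  have b3 := sum_E3_le i.hN i.D i.hk i.hcf v
  have b4 := sum_E4_le i.hN i.D i.hk (one_le_k i) i.hℓ i.hcf v
  have hS : ∑ y, wt i.hN i.D i.hk i.cf y * v y ^ 2 = ∑ y, a y ^ 2 := Finset.sum_congr rfl fun y _ => wt_mul_vOf_sq i a y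
  rw [hS] at b1 b2 b3 b4
  linarith

/-! ## §3 ★★★ (P′2) for the transported bumps -/

/-- ★★★ **(P′2) — THE TRANSPORTED TENT BUMPS ARE AN APPROXIMATE RIGHT INVERSE OF `Q(U)` AGAINST `Λ⁻¹`**: for every `SU(N)`-valued `U` and every `Ψ`,
`(1 − ⅞)·‖Ψ‖² ≤ Re tr⟨Q(U)(T_θΨ), Λ⁻¹Ψ⟩` for `θ = bumpProfile` (`B9Eq3132TentOperator.trIP_QY_tentOp_ge` + `cross_sum_le` at `a_y = ‖Ψ y‖_F`).
[cite: Balaban1984PropagatorsII, (2.147) p.248; Balaban1985BackgroundPropagators, (3.13) p.393, (3.132) p.422] -/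
theorem p2_bump {U : CfgY (Matrix (Fin N) (Fin N) ℂ) i} (hU : ∀ μ x, U μ x ∈ specialUnitaryUnits (Fin N)) (Ψ : IBondY i → Matrix (Fin N) (Fin N) ℂ) :
    (1 - 7 / 8) * trIP (fun _ => (1 : ℝ)) Ψ Ψ ≤ trIP (fun _ => (1 : ℝ)) (QY i (parBY i) U (tentOp i (bumpProfile i) U Ψ)) (fun y => lamInvY i y • Ψ y) := by
  have h0 := trIP_QY_tentOp_ge i (bumpProfile_ok i) hU Ψ
  have h1 := cross_sum_le i fun y => fro (Ψ y)
  rw [trIP_one_eq_sum_fro_sq]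
  linarith

/-- ★★★ **(P′2) AT A MEMBER OF def-Y's RECORD, FOR EVERY (3.35)-REGULAR BACKGROUND** — the first conjunct of `B9Eq3132CoerciveVariational.hcoA_of_testFamily`'s test-family
hypothesis `hT` for `T x U Ψ := tentOp x.toKIdx (bumpProfile x.toKIdx) U Ψ`, with the member-uniform defect `ϑ = ⅞ < 1`; (3.35) makes `U` `SU(N)`-valued, which is all
(P′2) uses. [cite: Balaban1984PropagatorsII, (2.147) p.248; Balaban1985BackgroundPropagators, (3.35) p.396, (3.132) p.422] -/
theorem p2_bump_member {Mstar : ℕ} (x : MemberY d ℓ hd hL b₀ b₁ Mstar) {c α₀ : ℝ} {U : (bg9Y (Matrix (Fin N) (Fin N) ℂ) (specialUnitaryUnits (Fin N)) x).Cfg}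
    (hU : (bg9Y (Matrix (Fin N) (Fin N) ℂ) (specialUnitaryUnits (Fin N)) x).Reg335 c α₀ U) (Ψ : IBondY x.toKIdx → Matrix (Fin N) (Fin N) ℂ) :
    (1 - 7 / 8) * trIP (fun _ => (1 : ℝ)) Ψ Ψ ≤
      trIP (fun _ => (1 : ℝ)) (QY x.toKIdx (parBY x.toKIdx) U (tentOp x.toKIdx (bumpProfile x.toKIdx) U Ψ)) (fun y => lamInvY x.toKIdx y • Ψ y) :=
  p2_bump x.toKIdx (fun μ z => B9BackgroundsKLevelV1.mem_of_reg335 x.toKIdx hU.1 μ z) Ψ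

end Literature.MathematicalPhysics.QuantumFieldTheory.Balaban1983to89.B9Eq3132ApproxRightInverse

end
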